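import Mathlib
import Literature.NumberTheory.Congruences.LjunggrenBinomialCongruence

/-!
# AperyFrobeniusFactorisation — the exact Frobenius factorisation `R_{np}(pt) = p⁻²·Φ_{n,p}(t)·R_n(t)` of the
Apéry kernels (cell zeta5-irr)

HONEST FRAMING: systematic search; no irrationality claim unless certified. INSTRUMENT lemma of the ζ(5)
census cell zeta5-irr (HOME `run/shared/lean/pub/zeta5-irr/`; memo `zi-p2/LEMMAS.md` §B8-a THEOREM 2 (i) and
§B8-a′ THEOREM 3, proof file `zi-p2/probes/B8/thm3-j246682/THEOREM3.md` Step 1, certificate kit j246682 C-1).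
Nothing here is about ζ(5); no irrationality content; filing moves no rung. Filed by the cell's engine seat
zi-eng (g6).

## What the cell uses (THEOREM3.md, Step 1 «Frobenius factorisation, exact»)

For the two Apéry kernels — `ζ(3)`: `R_n(t) = ((t−n)_n)²/((t)_{n+1})² = ∏_{m=1}^{n}(t−m)² / ∏_{m=0}^{n}(t+m)²`,
`ζ(2)`: `R_n(t) = n!·(t−n)_n/((t)_{n+1})²` — and every `p ≥ 1`, `n`:
`R_{np}(pt) = p⁻²·Φ_{n,p}(t)·R_n(t)` with
`Φ_{n,p}(t) = ∏_{1≤ℓ≤np, p∤ℓ}(pt−ℓ)²·∏_{1≤ℓ≤np, p∤ℓ}(pt+ℓ)⁻²` (`ζ(3)`) resp.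
`Φ_{n,p}(t) = W·∏_{p∤ℓ}(pt−ℓ)·∏_{p∤ℓ}(pt+ℓ)⁻²`, `W = ∏_{1≤ℓ≤np, p∤ℓ} ℓ = (np)!/(pⁿ n!)` (`ζ(2)`).
«Proof: split each product over `ℓ` by `p ∣ ℓ` or not; the multiples of `p` give `pⁿ(t−n)_n`, resp.
`p^{n+1}(t)_{n+1}`; `(np)! = pⁿ n!·W`; the exponent of `p` is `n + n − 2(n+1) = −2` (ζ(2)) resp. `2n − 2(n+1) = −2`
(ζ(3)).»  This is the structural identity behind the cell's THEOREM 2 (digit supercongruence for the second solutions,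
`k < p`) and THEOREM 3 (all `n`), whose part (a) is the tree's
`Literature.Combinatorics.Enumerative.AperySupercongruences` (Gessel 1982 Thm 3 (i)).

## What is PROVED here (everything; standard axioms)

* the splitting of `[1, np]` and `[0, np]` by divisibility: `filter_dvd_Icc_eq_image`, `filter_dvd_range_eq_image`,
  `filter_not_dvd_range_eq`, and the product forms `prod_Icc_mul_eq_mul_prod_filter`,
  `prod_range_mul_succ_eq_mul_prod_filter` (any commutative monoid, any `p ≥ 1`);
* the three exact identities in any commutative ring: `prod_Icc_mul_sub` (numerator:
  `∏_{m≤np}(pt−m) = pⁿ·∏_{m≤n}(t−m)·∏_{p∤ℓ}(pt−ℓ)`), `prod_range_mul_add` (denominator: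
  `∏_{m≤np}(pt+m) = p^{n+1}·∏_{m≤n}(t+m)·∏_{p∤ℓ}(pt+ℓ)`), `factorial_mul_eq` (`(np)! = pⁿ·n!·W`);
* the kernels and the factorisation in any field with `(p : K) ≠ 0`, for EVERY `t` (Lean's `x/0 = 0` makes the
  identities hold at the poles too): `kernel3_mul_eq` (`ζ(3)`) and `kernel2_mul_eq` (`ζ(2)`).

* (appendix, zi-eng g6 second filing) THEOREM3 Step 2, VALUE PART, cleared of denominators: the non-multiples of
  `p` in `[1, np]` as `n` residue blocks (`filter_not_dvd_Icc_eq_image`, `prod_filter_not_dvd_eq_prod_prod`), the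
  block congruences `∏_{p∤ℓ≤np}(jp+ℓ) ≡ ((p−1)!)ⁿ ≡ ∏_{p∤ℓ≤np}(ℓ−jp) (mod p³)` for a prime `p ≥ 5` and every integer `j`
  (`prod_filter_mul_add_modEq`, `prod_filter_sub_mul_modEq`, from the tree's Glaisher block congruence
  `Ljunggren.prod_mul_add_modEq`), hence `Φ_{n,p}(−j) ≡ 1 (mod p³)` in the form `p³ ∣ N − D`, `p ∤ D` for the
  numerator/denominator of `Φ_{n,p}(−j)` (`pow_three_dvd_phi3_num_sub_den`, `pow_three_dvd_phi2_num_sub_den`,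
  `not_dvd_prod_filter_sub_mul`).

Not covered: the DERIVATIVE part `Φ′_{n,p}(−j) ≡ 0 (mod p³)` of THEOREM3 Step 2 (= THEOREM 2 (ii) coefficientwise in
`T`; its printed inputs are the tree's `Ljunggren.block_congruence` and Carlitz's `Ljunggren.sq_dvd_num_sum_inv_block`),
and the off-digit coefficient lemma (Step 4).
-/

namespace Summit.KontsevichZagierPeriods.Zeta5Search.FrobeniusFactorisation

open Finset Nat
open Literature.NumberTheory.Congruences (Ljunggren.prod_mul_add_modEq)

/-! ## Splitting `[1, np]` and `[0, np]` by divisibility by `p` -/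

section splitting

variable {p : ℕ}

/-- The multiples of `p` in `[1, np]` are `p·[1, n]`. [folklore] -/
theorem filter_dvd_Icc_eq_image (hp : 0 < p) (n : ℕ) :
    (Icc 1 (n * p)).filter (fun m => p ∣ m) = (Icc 1 n).image (fun m => p * m) := by
  ext m
  simp only [mem_filter, mem_Icc, mem_image]
  constructor
  · rintro ⟨⟨h1, h2⟩, k, rfl⟩
    refine ⟨k, ⟨?_, ?_⟩, rfl⟩
    · rcases Nat.eq_zero_or_pos k with hk | hk
      · subst hk; omega
      · exact hk
    · exact Nat.le_of_mul_le_mul_left (by rwa [mul_comm n p] at h2) hp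
  · rintro ⟨k, ⟨hk1, hk2⟩, rfl⟩
    refine ⟨⟨Nat.mul_pos hp hk1, ?_⟩, dvd_mul_right p k⟩
    rw [mul_comm n p]
    exact Nat.mul_le_mul_left p hk2

/-- The multiples of `p` in `[0, np]` are `p·[0, n]`. [folklore] -/
theorem filter_dvd_range_eq_image (hp : 0 < p) (n : ℕ) :
    (range (n * p + 1)).filter (fun m => p ∣ m) = (range (n + 1)).image (fun m => p * m) := by
  ext m
  simp only [mem_filter, mem_range, mem_image]
  constructor
  · rintro ⟨h, k, rfl⟩
    refine ⟨k, ?_, rfl⟩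
    have : p * k ≤ p * n := by rw [mul_comm p n]; omega
    have := Nat.le_of_mul_le_mul_left this hp
    omega
  · rintro ⟨k, hk, rfl⟩
    refine ⟨?_, dvd_mul_right p k⟩
    have := Nat.mul_le_mul_left p (Nat.lt_succ_iff.1 hk)
    rw [mul_comm p n] at this
    omega

omit p in
/-- The non-multiples of `p` in `[0, np]` are those in `[1, np]` (`0` is a multiple). [folklore] -/
theorem filter_not_dvd_range_eq (p n : ℕ) :
    (range (n * p + 1)).filter (fun m => ¬ p ∣ m) = (Icc 1 (n * p)).filter (fun m => ¬ p ∣ m) := by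
  ext m
  simp only [mem_filter, mem_range, mem_Icc]
  constructor
  · rintro ⟨h, hnd⟩
    refine ⟨⟨?_, by omega⟩, hnd⟩
    rcases Nat.eq_zero_or_pos m with hm | hm
    · exact absurd (hm ▸ dvd_zero p) hnd
    · exact hm
  · rintro ⟨⟨h1, h2⟩, hnd⟩
    exact ⟨by omega, hnd⟩

variable {M : Type*} [CommMonoid M]

/-- `∏_{1≤m≤np} f(m) = ∏_{1≤m≤n} f(pm) · ∏_{1≤ℓ≤np, p∤ℓ} f(ℓ)`. [folklore] -/
@[to_additive /-- `Σ_{1≤m≤np} f(m) = Σ_{1≤m≤n} f(pm) + Σ_{1≤ℓ≤np, p∤ℓ} f(ℓ)`. [folklore] -/]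
theorem prod_Icc_mul_eq_mul_prod_filter (hp : 0 < p) (n : ℕ) (f : ℕ → M) :
    ∏ m ∈ Icc 1 (n * p), f m =
      (∏ m ∈ Icc 1 n, f (p * m)) * ∏ m ∈ (Icc 1 (n * p)).filter (fun m => ¬ p ∣ m), f m := by
  rw [← Finset.prod_filter_mul_prod_filter_not (Icc 1 (n * p)) (fun m => p ∣ m),
    filter_dvd_Icc_eq_image hp n, Finset.prod_image]
  intro x _ y _ h
  exact Nat.eq_of_mul_eq_mul_left hp h

/-- `∏_{0≤m≤np} f(m) = ∏_{0≤m≤n} f(pm) · ∏_{1≤ℓ≤np, p∤ℓ} f(ℓ)`. [folklore] -/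
@[to_additive /-- `Σ_{0≤m≤np} f(m) = Σ_{0≤m≤n} f(pm) + Σ_{1≤ℓ≤np, p∤ℓ} f(ℓ)`. [folklore] -/]
theorem prod_range_mul_succ_eq_mul_prod_filter (hp : 0 < p) (n : ℕ) (f : ℕ → M) :
    ∏ m ∈ range (n * p + 1), f m =
      (∏ m ∈ range (n + 1), f (p * m)) * ∏ m ∈ (Icc 1 (n * p)).filter (fun m => ¬ p ∣ m), f m := by
  rw [← Finset.prod_filter_mul_prod_filter_not (range (n * p + 1)) (fun m => p ∣ m),
    filter_dvd_range_eq_image hp n, filter_not_dvd_range_eq, Finset.prod_image]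
  intro x _ y _ h
  exact Nat.eq_of_mul_eq_mul_left hp h

end splitting

/-! ## The three exact identities (numerator, denominator, `(np)!`) -/

section identities

variable {R : Type*} [CommRing R] {p : ℕ}

/-- **Numerator**: `∏_{1≤m≤np}(pt − m) = pⁿ · ∏_{1≤m≤n}(t − m) · ∏_{1≤ℓ≤np, p∤ℓ}(pt − ℓ)` («the multiples of `p`
give `pⁿ(t−n)_n`»; zi-p2 THEOREM3.md Step 1). -/
theorem prod_Icc_mul_sub (hp : 0 < p) (n : ℕ) (t : R) :
    ∏ m ∈ Icc 1 (n * p), ((p : R) * t - m) =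
      (p : R) ^ n * (∏ m ∈ Icc 1 n, (t - m)) *
        ∏ m ∈ (Icc 1 (n * p)).filter (fun m => ¬ p ∣ m), ((p : R) * t - m) := by
  rw [prod_Icc_mul_eq_mul_prod_filter hp n (fun m => (p : R) * t - m)]
  congr 1
  have h : ∀ m ∈ Icc 1 n, ((p : R) * t - ((p * m : ℕ) : R)) = (p : R) * (t - m) := by
    intro m _; push_cast; ring
  rw [Finset.prod_congr rfl h, Finset.prod_mul_distrib, Finset.prod_const, Nat.card_Icc,
    Nat.add_sub_cancel]

/-- **Denominator**: `∏_{0≤m≤np}(pt + m) = p^{n+1} · ∏_{0≤m≤n}(t + m) · ∏_{1≤ℓ≤np, p∤ℓ}(pt + ℓ)` («resp.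
`p^{n+1}(t)_{n+1}`»; zi-p2 THEOREM3.md Step 1). -/
theorem prod_range_mul_add (hp : 0 < p) (n : ℕ) (t : R) :
    ∏ m ∈ range (n * p + 1), ((p : R) * t + m) =
      (p : R) ^ (n + 1) * (∏ m ∈ range (n + 1), (t + m)) *
        ∏ m ∈ (Icc 1 (n * p)).filter (fun m => ¬ p ∣ m), ((p : R) * t + m) := by
  rw [prod_range_mul_succ_eq_mul_prod_filter hp n (fun m => (p : R) * t + m)]
  congr 1
  have h : ∀ m ∈ range (n + 1), ((p : R) * t + ((p * m : ℕ) : R)) = (p : R) * (t + m) := by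
    intro m _; push_cast; ring
  rw [Finset.prod_congr rfl h, Finset.prod_mul_distrib, Finset.prod_const, Finset.card_range]

omit p in
/-- `∏_{1≤m≤N} m = N!`. [folklore] -/
private theorem prod_Icc_id_eq_factorial : ∀ N : ℕ, ∏ m ∈ Icc 1 N, m = N !
  | 0 => by simp
  | N + 1 => by
      rw [Finset.prod_Icc_succ_top (by omega), prod_Icc_id_eq_factorial N, Nat.factorial_succ, mul_comm]

/-- **`(np)! = pⁿ · n! · W`** with `W = ∏_{1≤ℓ≤np, p∤ℓ} ℓ` (zi-p2 THEOREM3.md Step 1). -/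
theorem factorial_mul_eq (hp : 0 < p) (n : ℕ) :
    (n * p)! = p ^ n * n ! * ∏ m ∈ (Icc 1 (n * p)).filter (fun m => ¬ p ∣ m), m := by
  rw [← prod_Icc_id_eq_factorial (n * p), prod_Icc_mul_eq_mul_prod_filter hp n (fun m => m),
    Finset.prod_mul_distrib, Finset.prod_const, Nat.card_Icc, Nat.add_sub_cancel,
    prod_Icc_id_eq_factorial]

end identities

/-! ## The kernels and the factorisation `R_{np}(pt) = p⁻² Φ_{n,p}(t) R_n(t)` -/

section kernels

variable {K : Type*} [Field K] {p : ℕ}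

/-- The Apéry `ζ(3)` kernel `R_n(t) = ∏_{m=1}^{n}(t−m)² / ∏_{m=0}^{n}(t+m)²` (`= ((t−n)_n)²/((t)_{n+1})²`). -/
def kernel3 (n : ℕ) (t : K) : K :=
  (∏ m ∈ Icc 1 n, (t - m)) ^ 2 / (∏ m ∈ range (n + 1), (t + m)) ^ 2

/-- The Frobenius factor `Φ_{n,p}(t) = ∏_{1≤ℓ≤np, p∤ℓ}(pt−ℓ)² / ∏_{1≤ℓ≤np, p∤ℓ}(pt+ℓ)²` of the `ζ(3)` kernel. -/
def phi3 (p n : ℕ) (t : K) : K :=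
  (∏ m ∈ (Icc 1 (n * p)).filter (fun m => ¬ p ∣ m), ((p : K) * t - m)) ^ 2 /
    (∏ m ∈ (Icc 1 (n * p)).filter (fun m => ¬ p ∣ m), ((p : K) * t + m)) ^ 2

/-- The Apéry `ζ(2)` kernel `R_n(t) = n! · ∏_{m=1}^{n}(t−m) / ∏_{m=0}^{n}(t+m)²` (`= n!(t−n)_n/((t)_{n+1})²`). -/
def kernel2 (n : ℕ) (t : K) : K :=
  (n ! : K) * (∏ m ∈ Icc 1 n, (t - m)) / (∏ m ∈ range (n + 1), (t + m)) ^ 2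

/-- The Frobenius factor `Φ_{n,p}(t) = W · ∏_{p∤ℓ}(pt−ℓ) / ∏_{p∤ℓ}(pt+ℓ)²`, `W = ∏_{1≤ℓ≤np, p∤ℓ} ℓ`, of the
`ζ(2)` kernel. -/
def phi2 (p n : ℕ) (t : K) : K :=
  (((∏ m ∈ (Icc 1 (n * p)).filter (fun m => ¬ p ∣ m), m : ℕ) : K) *
      ∏ m ∈ (Icc 1 (n * p)).filter (fun m => ¬ p ∣ m), ((p : K) * t - m)) /
    (∏ m ∈ (Icc 1 (n * p)).filter (fun m => ¬ p ∣ m), ((p : K) * t + m)) ^ 2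

/-- Algebra of the `ζ(3)` case: `(xⁿ a c)²/((x^{n+1} b d)²) = (x²)⁻¹ · (c²/d²) · (a²/b²)` for `x ≠ 0` and ALL
`a b c d` (both sides vanish when `b = 0` or `d = 0`). [folklore] -/
private theorem sq_div_sq_eq {x : K} (hx : x ≠ 0) (n : ℕ) (a b c d : K) :
    (x ^ n * a * c) ^ 2 / (x ^ (n + 1) * b * d) ^ 2 = (x ^ 2)⁻¹ * (c ^ 2 / d ^ 2) * (a ^ 2 / b ^ 2) := by
  by_cases hb : b = 0
  · simp [hb]
  by_cases hd : d = 0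
  · simp [hd]
  field_simp
  ring

/-- Algebra of the `ζ(2)` case: `(xⁿ e w)(xⁿ a c)/((x^{n+1} b d)²) = (x²)⁻¹ · (w c/d²) · (e a/b²)` for `x ≠ 0` and
ALL `a b c d e w`. [folklore] -/
private theorem mul_div_sq_eq {x : K} (hx : x ≠ 0) (n : ℕ) (a b c d e w : K) :
    x ^ n * e * w * (x ^ n * a * c) / (x ^ (n + 1) * b * d) ^ 2 =
      (x ^ 2)⁻¹ * (w * c / d ^ 2) * (e * a / b ^ 2) := by
  by_cases hb : b = 0
  · simp [hb]
  by_cases hd : d = 0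
  · simp [hd]
  field_simp
  ring

/-- **Frobenius factorisation, `ζ(3)` kernel** (zi-p2 THEOREM 2 (i) / THEOREM3.md Step 1): for `p ≥ 1` invertible
in `K` and every `n`, `t`: `R_{np}(pt) = p⁻²·Φ_{n,p}(t)·R_n(t)`. -/
theorem kernel3_mul_eq (hp : 0 < p) (hpK : (p : K) ≠ 0) (n : ℕ) (t : K) :
    kernel3 (n * p) ((p : K) * t) = ((p : K) ^ 2)⁻¹ * phi3 p n t * kernel3 n t := by
  unfold kernel3 phi3
  rw [prod_Icc_mul_sub hp n t, prod_range_mul_add hp n t]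
  exact sq_div_sq_eq hpK n _ _ _ _

/-- **Frobenius factorisation, `ζ(2)` kernel** (zi-p2 THEOREM3.md Step 1): for `p ≥ 1` invertible in `K` and
every `n`, `t`: `R_{np}(pt) = p⁻²·Φ_{n,p}(t)·R_n(t)` with `Φ_{n,p} = W·∏_{p∤ℓ}(pt−ℓ)/∏_{p∤ℓ}(pt+ℓ)²`. -/
theorem kernel2_mul_eq (hp : 0 < p) (hpK : (p : K) ≠ 0) (n : ℕ) (t : K) :
    kernel2 (n * p) ((p : K) * t) = ((p : K) ^ 2)⁻¹ * phi2 p n t * kernel2 n t := by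
  unfold kernel2 phi2
  rw [prod_Icc_mul_sub hp n t, prod_range_mul_add hp n t, factorial_mul_eq hp n]
  push_cast
  exact mul_div_sq_eq hpK n _ _ _ _ _ _

/-- Sanity instance (`ζ(3)`, `n = 1`, `p = 2`, `t = 3` in `ℚ`): `R_2(6) = ¼·Φ_{1,2}(3)·R_1(3)`, i.e.
`(5·4)²/(6·7·8)² = ¼ · (5²/7²) · (2²/(3·4)²)`. -/
example : kernel3 (1 * 2) ((2 : ℚ) * 3) = ((2 : ℚ) ^ 2)⁻¹ * phi3 2 1 (3 : ℚ) * kernel3 1 (3 : ℚ) :=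
  kernel3_mul_eq (by norm_num) (by norm_num) 1 3

end kernels

/-! ## The non-multiples of `p` in `[1, np]` as `n` residue blocks, and `Φ_{n,p}(−j) ≡ 1 (mod p³)` -/

section blocks

variable {p : ℕ}

/-- The non-multiples of `p` in `[1, np]` are the `n` blocks `{bp + r : 1 ≤ r ≤ p − 1}`, `b < n`. [folklore] -/
theorem filter_not_dvd_Icc_eq_image (hp : 0 < p) (n : ℕ) :
    (Icc 1 (n * p)).filter (fun m => ¬ p ∣ m) =
      ((range n) ×ˢ (Icc 1 (p - 1))).image (fun br : ℕ × ℕ => br.1 * p + br.2) := by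
  ext m
  simp only [mem_filter, mem_Icc, mem_image, mem_product, mem_range, Prod.exists]
  constructor
  · rintro ⟨⟨h1, h2⟩, hnd⟩
    have hmod : 0 < m % p := Nat.pos_of_ne_zero fun h0 => hnd (Nat.dvd_of_mod_eq_zero h0)
    have hdm := Nat.div_add_mod' m p
    have hlt := Nat.mod_lt m hp
    refine ⟨m / p, m % p, ⟨?_, by omega, by omega⟩, hdm⟩
    rcases Nat.lt_or_ge (m / p) n with h | h
    · exact h
    · have : n * p ≤ m / p * p := Nat.mul_le_mul_right p h
      omega
  · rintro ⟨b, r, ⟨hb, hr1, hr2⟩, rfl⟩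
    have hn : 1 ≤ n := by omega
    have hbp : b * p ≤ (n - 1) * p := Nat.mul_le_mul_right p (by omega)
    have hnp : (n - 1) * p + p = n * p := by
      have e : (n - 1 + 1) * p = (n - 1) * p + p := by ring
      rw [Nat.sub_add_cancel hn] at e
      exact e.symm
    refine ⟨⟨by omega, by omega⟩, fun hd => ?_⟩
    have hr : p ∣ r := (Nat.dvd_add_right (dvd_mul_left p b)).1 hd
    have := Nat.le_of_dvd (by omega) hr
    omega

variable {M : Type*} [CommMonoid M]

/-- `∏_{1≤ℓ≤np, p∤ℓ} f(ℓ) = ∏_{b<n} ∏_{r=1}^{p−1} f(bp + r)`. [folklore] -/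
@[to_additive /-- `Σ_{1≤ℓ≤np, p∤ℓ} f(ℓ) = Σ_{b<n} Σ_{r=1}^{p−1} f(bp + r)`. [folklore] -/]
theorem prod_filter_not_dvd_eq_prod_prod (hp : 0 < p) (n : ℕ) (f : ℕ → M) :
    ∏ m ∈ (Icc 1 (n * p)).filter (fun m => ¬ p ∣ m), f m =
      ∏ b ∈ range n, ∏ r ∈ Icc 1 (p - 1), f (b * p + r) := by
  rw [filter_not_dvd_Icc_eq_image hp n, Finset.prod_image, Finset.prod_product]
  rintro ⟨b, r⟩ h ⟨b', r'⟩ h' heq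
  simp only [coe_product, Set.mem_prod, mem_coe, mem_range, mem_Icc] at h h'
  simp only at heq
  have e1 : (b * p + r) % p = (b' * p + r') % p := by rw [heq]
  rw [Nat.mul_add_mod', Nat.mul_add_mod', Nat.mod_eq_of_lt (by omega), Nat.mod_eq_of_lt (by omega)] at e1
  subst e1
  have e2 : b * p = b' * p := by omega
  rw [Prod.mk.injEq]
  exact ⟨Nat.eq_of_mul_eq_mul_right hp e2, rfl⟩

/-- **Numerator blocks at a digit point** (zi-p2 THEOREM3.md Step 2, value part): for a prime `p ≥ 5`, every `n`
and every integer `j`, `∏_{1≤ℓ≤np, p∤ℓ}(jp + ℓ) ≡ ((p−1)!)ⁿ (mod p³)` — `n` complete residue blocks, each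
`≡ (p−1)!` by Glaisher's block congruence (tree: `Ljunggren.prod_mul_add_modEq`). -/
theorem prod_filter_mul_add_modEq (hp : p.Prime) (h3 : 3 < p) (n : ℕ) (j : ℤ) :
    ∏ m ∈ (Icc 1 (n * p)).filter (fun m => ¬ p ∣ m), (j * p + (m : ℤ))
      ≡ (((p - 1)! : ℕ) : ℤ) ^ n [ZMOD (p : ℤ) ^ 3] := by
  rw [prod_filter_not_dvd_eq_prod_prod hp.pos n (fun m => j * p + (m : ℤ)),
    show (((p - 1)! : ℕ) : ℤ) ^ n = ∏ _b ∈ range n, (((p - 1)! : ℕ) : ℤ) by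
      rw [Finset.prod_const, Finset.card_range]]
  refine Int.ModEq.prod fun b _ => ?_
  have e : ∏ r ∈ Icc 1 (p - 1), (j * p + (((b * p + r : ℕ)) : ℤ)) =
      ∏ r ∈ Icc 1 (p - 1), ((j + b) * p + (r : ℤ)) :=
    Finset.prod_congr rfl fun r _ => by push_cast; ring
  rw [e]
  exact Ljunggren.prod_mul_add_modEq hp h3 (j + b)

/-- **Denominator blocks at a digit point** (zi-p2 THEOREM3.md Step 2, value part): for a prime `p ≥ 5`, every
`n` and every integer `j`, `∏_{1≤ℓ≤np, p∤ℓ}(ℓ − jp) ≡ ((p−1)!)ⁿ (mod p³)` (blocks `((b−j)p + r)_r`, `b < n`, negative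
`b − j` included). -/
theorem prod_filter_sub_mul_modEq (hp : p.Prime) (h3 : 3 < p) (n : ℕ) (j : ℤ) :
    ∏ m ∈ (Icc 1 (n * p)).filter (fun m => ¬ p ∣ m), ((m : ℤ) - j * p)
      ≡ (((p - 1)! : ℕ) : ℤ) ^ n [ZMOD (p : ℤ) ^ 3] := by
  rw [prod_filter_not_dvd_eq_prod_prod hp.pos n (fun m => (m : ℤ) - j * p),
    show (((p - 1)! : ℕ) : ℤ) ^ n = ∏ _b ∈ range n, (((p - 1)! : ℕ) : ℤ) by
      rw [Finset.prod_const, Finset.card_range]]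
  refine Int.ModEq.prod fun b _ => ?_
  have e : ∏ r ∈ Icc 1 (p - 1), ((((b * p + r : ℕ)) : ℤ) - j * p) =
      ∏ r ∈ Icc 1 (p - 1), (((b : ℤ) - j) * p + (r : ℤ)) :=
    Finset.prod_congr rfl fun r _ => by push_cast; ring
  rw [e]
  exact Ljunggren.prod_mul_add_modEq hp h3 ((b : ℤ) - j)

/-- **`Φ_{n,p}(−j) ≡ 1 (mod p³)`, cleared of denominators** (zi-p2 THEOREM3.md Step 2 / LEMMAS THEOREM 2 (ii), value
part, `ζ(3)` kernel): for a prime `p ≥ 5`, every `n` and every integer `j`, the numerator `N = ∏_{p∤ℓ}(jp+ℓ)²` and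
the denominator `D = ∏_{p∤ℓ}(ℓ−jp)²` of `Φ_{n,p}(−j)` satisfy `p³ ∣ N − D` (both are `≡ ((p−1)!)^{2n}`). -/
theorem pow_three_dvd_phi3_num_sub_den (hp : p.Prime) (h3 : 3 < p) (n : ℕ) (j : ℤ) :
    (p : ℤ) ^ 3 ∣ (∏ m ∈ (Icc 1 (n * p)).filter (fun m => ¬ p ∣ m), (j * p + (m : ℤ))) ^ 2
      - (∏ m ∈ (Icc 1 (n * p)).filter (fun m => ¬ p ∣ m), ((m : ℤ) - j * p)) ^ 2 :=
  (((prod_filter_sub_mul_modEq hp h3 n j).pow 2).trans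
    ((prod_filter_mul_add_modEq hp h3 n j).pow 2).symm).dvd

/-- The denominator `D` is prime to `p` (each block is `≡ (p−1)!`, a unit mod `p`): `¬ p ∣ ∏_{p∤ℓ}(ℓ − jp)`. -/
theorem not_dvd_prod_filter_sub_mul (hp : p.Prime) (h3 : 3 < p) (n : ℕ) (j : ℤ) :
    ¬ (p : ℤ) ∣ ∏ m ∈ (Icc 1 (n * p)).filter (fun m => ¬ p ∣ m), ((m : ℤ) - j * p) := by
  intro hd
  -- `p ∣ D` and `p³ ∣ D − ((p−1)!)ⁿ` give `p ∣ ((p−1)!)ⁿ`, impossible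
  have hF : (p : ℤ) ∣ (((p - 1)! : ℕ) : ℤ) ^ n := by
    have h := (prod_filter_sub_mul_modEq hp h3 n j).symm.dvd
    have h' := (dvd_pow_self (p : ℤ) three_ne_zero).trans h
    have h'' := dvd_sub hd h'
    rwa [sub_sub_cancel] at h''
  have h2 : (p : ℤ) ∣ (((p - 1)! : ℕ) : ℤ) := Int.Prime.dvd_pow' hp hF
  have h4 : p ∣ (p - 1)! := Int.natCast_dvd_natCast.1 h2
  rw [hp.dvd_factorial] at h4
  have := hp.one_lt
  omega

/-- **`Φ_{n,p}(−j) ≡ 1 (mod p³)`, `ζ(2)` kernel, cleared of denominators**: with `W = ∏_{p∤ℓ≤np} ℓ`,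
`N = W·∏_{p∤ℓ}(jp+ℓ)` and `D = ∏_{p∤ℓ}(ℓ−jp)²` one has `p³ ∣ N − D` (all three products are `≡ ((p−1)!)ⁿ`). -/
theorem pow_three_dvd_phi2_num_sub_den (hp : p.Prime) (h3 : 3 < p) (n : ℕ) (j : ℤ) :
    (p : ℤ) ^ 3 ∣ ((∏ m ∈ (Icc 1 (n * p)).filter (fun m => ¬ p ∣ m), m : ℕ) : ℤ) *
        (∏ m ∈ (Icc 1 (n * p)).filter (fun m => ¬ p ∣ m), (j * p + (m : ℤ)))
      - (∏ m ∈ (Icc 1 (n * p)).filter (fun m => ¬ p ∣ m), ((m : ℤ) - j * p)) ^ 2 := by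
  have hW : ((∏ m ∈ (Icc 1 (n * p)).filter (fun m => ¬ p ∣ m), m : ℕ) : ℤ)
      ≡ (((p - 1)! : ℕ) : ℤ) ^ n [ZMOD (p : ℤ) ^ 3] := by
    have h := prod_filter_mul_add_modEq hp h3 n 0
    simp only [zero_mul, zero_add] at h
    push_cast
    exact h
  have hN := hW.mul (prod_filter_mul_add_modEq hp h3 n j)
  have hD := (prod_filter_sub_mul_modEq hp h3 n j).pow 2
  rw [← pow_two] at hN
  exact (hD.trans hN.symm).dvd
end blocks

end Summit.KontsevichZagierPeriods.Zeta5Search.FrobeniusFactorisation
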